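import Summits.CriticalPhenomena.PercolationContinuityZ3.Theorems.PercNearOneGluingNoHeavyLowerTailClusterDeletion
import HarnessLib

/-!
# `NoHeavyLowerTail` (stmt-CriticalPhenomena-4575) — the cluster-deletion step for the BLOCK-CHAMPION
# (PL-block) potential closes the crux

Prover `prim-lf-5` (lemma factory #5), gen 3, 2026-08-19; `--supports stmt-CriticalPhenomena-4575`.  No definitions,
no named facts, no sorries.  Companion of `…ClusterDeletion.lean` (`noHeavyLowerTail_of_clusterDeletionStep`, any
potential): here the potential is instantiated with the BLOCK-CHAMPION bound

  `Φ(w, A, o, j) = Σ_{B ⊆ A} μ_w{π(o) = B} · max_{c ∈ B} μ_w{|π(c)| ≤ j} = E[max_{c ∈ π(o)} μ{|π(c)| ≤ j}; π(o) ≠ ∅]`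

(`π(v) = {a ∈ A : v ↔ a}`; the maximum over the empty block is `0`) — the "PL-block" bound of the tie-locus seat
(registered stub `stub_blockLightest`: `bad ≤ Φ`, 0 violations) alias the form `U` of prim-gen-swap.  Written out as a
lambda (no definition).  We prove the two admissibility hypotheses of the abstract reduction for this `Φ`
(`blockChampion_nonneg`, `blockChampion_le_lightness`: `0 ≤ Φ ≤ μ{|π(a⋆)| ≤ j}` for a lightness champion `a⋆`)
and obtain the typed target

* `noHeavyLowerTail_of_blockChampionDeletionStep` — if every instance has a relay `y ∈ A` with
  `μ{o ↔ y, |π(y)| ≤ j} + C · Σ_{K ∋ y, K ∌ o} μ{C(y) = K} · Φ(w ∖ K, A ∖ K, o, j) ≤ C · Φ(w, A, o, j)`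
  (the inequality `ΦD_C` of run/shared/lean/prim/prim-lf-5/CANDIDATES.md v7, ttrl2 request
  `lf5-phid-cluster-deletion`; 0 violations in the seat's exact census), then `NoHeavyLowerTail`.
-/

namespace Summit.CriticalPhenomena.PercolationContinuityZ3.Theorems

open MeasureTheory Set
open Literature.Probability.LatticeModels (prodBernoulli)
open Literature.Probability.Percolation (BondConfig openConn openCluster)
open scoped BigOperators

noncomputable section
open Classical

variable {n : ℕ}

namespace ClusterDeletion

/-- The block-champion potential is nonnegative. [this work] -/
theorem blockChampion_nonneg (w : Sym2 (Fin n) → unitInterval) (A : Finset (Fin n)) (o : Fin n) (j : ℕ) :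
    0 ≤ ∑ B ∈ A.powerset,
        (prodBernoulli w).real {ω : BondConfig (Fin n) | (A.filter fun x => ω ∈ openConn o x) = B} *
          (if h : B.Nonempty then
              B.sup' h (fun c => (prodBernoulli w).real
                {ω : BondConfig (Fin n) | (A.filter fun x => ω ∈ openConn c x).card ≤ j})
            else 0) := by
  refine Finset.sum_nonneg fun B _ => mul_nonneg measureReal_nonneg ?_
  split_ifs with h
  · obtain ⟨c, hc⟩ := h
    exact le_trans measureReal_nonneg (Finset.le_sup' (fun c => (prodBernoulli w).real
      {ω : BondConfig (Fin n) | (A.filter fun x => ω ∈ openConn c x).card ≤ j}) hc)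
  · exact le_rfl

/-- The events `{π(o) = B}`, `B ⊆ A`, have total mass at most `1`. [folklore] -/
theorem sum_block_le_one (w : Sym2 (Fin n) → unitInterval) (A : Finset (Fin n)) (o : Fin n) :
    ∑ B ∈ A.powerset,
        (prodBernoulli w).real {ω : BondConfig (Fin n) | (A.filter fun x => ω ∈ openConn o x) = B} ≤ 1 := by
  rw [← measureReal_biUnion_finset]
  · exact measureReal_le_one
  · intro B _ B' _ hBB'
    refine Set.disjoint_left.2 fun ω h h' => hBB' ?_
    have h1 : (A.filter fun x => ω ∈ openConn o x) = B := h
    have h2 : (A.filter fun x => ω ∈ openConn o x) = B' := h'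
    rw [← h1, ← h2]
  · exact fun _ _ => (Set.toFinite _).measurableSet

/-- **The block-champion potential is at most the lightness of a champion**: for `A ≠ ∅` there is `a⋆ ∈ A`
(a maximiser of `μ{|π(·)| ≤ j}`) with `Φ(w, A, o, j) ≤ μ{|π(a⋆)| ≤ j}`. [this work] -/
theorem blockChampion_le_lightness (w : Sym2 (Fin n) → unitInterval) (A : Finset (Fin n)) (o : Fin n)
    (j : ℕ) (hA : A.Nonempty) :
    ∃ a ∈ A, (∑ B ∈ A.powerset,
        (prodBernoulli w).real {ω : BondConfig (Fin n) | (A.filter fun x => ω ∈ openConn o x) = B} *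
          (if h : B.Nonempty then
              B.sup' h (fun c => (prodBernoulli w).real
                {ω : BondConfig (Fin n) | (A.filter fun x => ω ∈ openConn c x).card ≤ j})
            else 0)) ≤
      (prodBernoulli w).real {ω : BondConfig (Fin n) | (A.filter fun x => ω ∈ openConn a x).card ≤ j} := by
  set I : Fin n → ℝ := fun c => (prodBernoulli w).real
    {ω : BondConfig (Fin n) | (A.filter fun x => ω ∈ openConn c x).card ≤ j} with hI
  obtain ⟨a, ha, hmax⟩ := Finset.exists_max_image A I hA
  refine ⟨a, ha, ?_⟩
  have hIa : 0 ≤ I a := measureReal_nonneg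
  calc ∑ B ∈ A.powerset,
        (prodBernoulli w).real {ω : BondConfig (Fin n) | (A.filter fun x => ω ∈ openConn o x) = B} *
          (if h : B.Nonempty then B.sup' h I else 0)
      ≤ ∑ B ∈ A.powerset,
          (prodBernoulli w).real {ω : BondConfig (Fin n) | (A.filter fun x => ω ∈ openConn o x) = B} *
            I a := by
        refine Finset.sum_le_sum fun B hB => mul_le_mul_of_nonneg_left ?_ measureReal_nonneg
        split_ifs with h
        · exact Finset.sup'_le h I fun c hc => hmax c (Finset.mem_powerset.1 hB hc)
        · exact hIa
    _ = (∑ B ∈ A.powerset,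
          (prodBernoulli w).real {ω : BondConfig (Fin n) | (A.filter fun x => ω ∈ openConn o x) = B}) *
            I a := (Finset.sum_mul _ _ _).symm
    _ ≤ 1 * I a := mul_le_mul_of_nonneg_right (sum_block_le_one w A o) hIa
    _ = I a := one_mul _

end ClusterDeletion

open ClusterDeletion in
/-- **The cluster-deletion step for the block-champion potential closes the crux.**  With
`Φ(w, A, o, j) = Σ_{B ⊆ A} μ_w{π(o) = B} · max_{c ∈ B} μ_w{|π(c)| ≤ j}` and `w ∖ K` = `w` with every pair meeting
`K` given weight `0`: if for some `C ≥ 0` every instance (`A ≠ ∅`, `o ∉ A`, any level `j`) has a relay `y ∈ A`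
with `μ_w{o ↔ y, |π(y)| ≤ j} + C · Σ_{K ∋ y, K ∌ o} μ_w{C(y) = K} · Φ(w ∖ K, A ∖ K, o, j) ≤ C · Φ(w, A, o, j)`,
then `NoHeavyLowerTail` holds (via `noHeavyLowerTail_of_clusterDeletionStep`).  This is the `exact` target for the
inequality `ΦD_C` of the blob/cluster-deletion line. [this work] -/
theorem noHeavyLowerTail_of_blockChampionDeletionStep (C : ℝ) (hC : 0 ≤ C)
    (hstep : ∀ (n : ℕ) (w : Sym2 (Fin n) → unitInterval) (A : Finset (Fin n)) (o : Fin n) (j : ℕ),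
      A.Nonempty → o ∉ A → ∃ y ∈ A,
        (prodBernoulli w).real (openConn o y ∩ {ω | (A.filter fun x => ω ∈ openConn y x).card ≤ j}) +
          C * ∑ K ∈ (Finset.univ : Finset (Finset (Fin n))).filter (fun K => y ∈ K ∧ o ∉ K),
            (prodBernoulli w).real {ω : BondConfig (Fin n) | openCluster ω y = (K : Set (Fin n))} *
              (∑ B ∈ (A \ K).powerset,
                (prodBernoulli (fun e : Sym2 (Fin n) =>
                    if ∃ v ∈ K, v ∈ e then (0 : unitInterval) else w e)).real
                  {ω : BondConfig (Fin n) | ((A \ K).filter fun x => ω ∈ openConn o x) = B} *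
                (if h : B.Nonempty then
                    B.sup' h (fun c => (prodBernoulli (fun e : Sym2 (Fin n) =>
                        if ∃ v ∈ K, v ∈ e then (0 : unitInterval) else w e)).real
                      {ω : BondConfig (Fin n) | ((A \ K).filter fun x => ω ∈ openConn c x).card ≤ j})
                  else 0))
        ≤ C * ∑ B ∈ A.powerset,
            (prodBernoulli w).real {ω : BondConfig (Fin n) | (A.filter fun x => ω ∈ openConn o x) = B} *
              (if h : B.Nonempty then
                  B.sup' h (fun c => (prodBernoulli w).real
                    {ω : BondConfig (Fin n) | (A.filter fun x => ω ∈ openConn c x).card ≤ j})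
                else 0)) :
    Summit.CriticalPhenomena.PercolationContinuityZ3.Theses.PercNearOneGluing.NoHeavyLowerTail :=
  noHeavyLowerTail_of_clusterDeletionStep C hC
    (fun n w A o j => ∑ B ∈ A.powerset,
        (prodBernoulli w).real {ω : BondConfig (Fin n) | (A.filter fun x => ω ∈ openConn o x) = B} *
          (if h : B.Nonempty then
              B.sup' h (fun c => (prodBernoulli w).real
                {ω : BondConfig (Fin n) | (A.filter fun x => ω ∈ openConn c x).card ≤ j})
            else 0))
    (fun _ w A o j => blockChampion_nonneg w A o j)
    (fun _ w A o j hA _ => blockChampion_le_lightness w A o j hA)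
    hstep

end

end Summit.CriticalPhenomena.PercolationContinuityZ3.Theorems

/-!
## Status 2026-08-19 (same seat, later the same day): the hypothesis `hstep` above is FALSE for every `C`

The reduction `noHeavyLowerTail_of_blockChampionDeletionStep` is correct but vacuous: its hypothesis (the inequality
`ΦD_C` of the blob/cluster-deletion line) fails for EVERY `C ≥ 0` on an explicit 7-vertex instance — observer `o`, relays
`1…6`, level `j = 1`, relay pairs `1–2 .580, 1–3 .754, 2–3 .681, 4–5 .139, 4–6 .911, 5–6 .795, 1–5 .250, 2–5 .412,
2–6 .016, 3–5 .013` (two mutually "cross-suppressing" triangles) and a weak observer `o–1 .204/200, o–2 .166/200,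
o–3 .239/200, o–4 .318/200, o–5 .073/200`: for EVERY relay `y` the deletion term alone exceeds the potential,
`Σ_K μ{C(y)=K}·Φ(w ∖ K, A ∖ K) > Φ(w, A)` (exact rationals; smallest ratio `1.000348` at `y = 2`), so no constant works.
Exact witness and the first-order matrix-game analysis that found it: run/shared/lean/prim/prim-lf-5/PHID-CEX-n7.json,
CLUSTER-DELETION.md §4–§6.  The general reduction `noHeavyLowerTail_of_clusterDeletionStep` (any potential `Ψ`) in
`…ClusterDeletion.lean` is unaffected; any future potential should first pass the game test documented there.
-/
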